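import Summits.QuantumFields.BalabanUV.T4Continuum.Support.NE7SliceGreenTorus
import Literature.MathematicalPhysics.QuantumFieldTheory.Balaban1983to89.B5G115SupBound
import HarnessLib

/-!
# NE7LandauLinearSup — THE LINEAR LANDAU LETTER OF REP♭ AT THE TRIVIAL FLAT DATUM, `k`- AND `N`-UNIFORM:
# for a torus vector field `x` with vanishing block average `Q_kx = 0`, the restricted gauge transform `x₂ := x − ∂λ₀(∂*x)`
# (B5's Landau function `λ₀`, `Q′_kλ₀ = 0`, `λ₀ ⊥ 1`) keeps `Q_kx₂ = 0` and the curl, satisfies Bałaban's gauge condition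
# `(1 − P)∂*x₂ = 0`, equals `Δ_1⁻¹(½∂ᴴ∂x)`, and obeys the SUP LETTER `|x₂| ≤ C(d)·sup|F(x)|`, the GRADIENT, LAPLACIAN and
# `∂∂*` LETTERS `|∇_νx₂|, |Δx₂|, |∂∂*x₂| ≤ C(d)·sup|½∂ᴴ∂x|` — for EVERY spacing `η = 1∕n` and EVERY period vector

Cell `pub-balaban`, rung (B)+1 sub-cell t4, lineage `b2b-balaban-t4-ne7-p1`, generation 73 (CRUX PROVER NE7 #1, OWNER row NE7).  Brick N2′ of the
REP♭ crux card (`t4/b2b-balaban-t4-ne7-p1-g72/REP-FLAT-CRUX-CARD.md` §3): the LINEAR engine of [B8] Theorem 2's sup member (1.36)₁ and Laplacian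
member (1.39) at the background `U₀ = 1`, on lit-balaban's typed torus carriers (`Tor (fine n M)`, `Q_k = QvOp` (1.18), `∂ = GradOp`, `∂ᵛ = CurlOp`,
`Δ_1 = DeltaA n M 1` (1.69), `P = PcT` (1.26), `λ₀ = lambda0` p. 22), i.e. the objects of G1 `NE7SliceGreenTorus` (p392706) and of GAN24's
`Entry110Rect` (p-ids of that lineage).
WHY.  After gen 72 the (APE) END at the trivial flat datum ((155) `NE7ApeTrivialFlatEndDischarged.smallField_of_trivialLetters_final`, G7
`NE7ApeTrivialFlatEndLinks`) is ONE kernel theorem conditional on REP♭⁻: a unitary periodic gauge in which the links of the tangent-critical fibre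
configuration `U` are within `r₀ ≲ δ∕M` of `1` with differences `≲ δ∕M²` (`M = L^{k+1}`).  The hierarchical axial gauge gives only `O(δ)`; the gain `1∕M` is
Landau-gauge content.  THIS FILE proves that gain in the LINEAR chart, uniformly in `k` AND in the number of blocks `N`: the mechanism is NOT a maximum
principle (`‖Δ_1⁻¹‖_{∞→∞}·‖∂*F‖_∞` loses the factor) but the third entry of [B5] (1.110)∕(1.115), `|Δ_1⁻¹∇*J| ≤ O(1)|J|` — the gradient of the constrained
Green's function has an integrable kernel —, kernel-proved for `a = 1` on every torus by GAN24 (`Entry110Rect.norm_inv_fdiffH_mulVec_le`), applied to the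
source written as a DIVERGENCE OF THE PLAQUETTE FIELD: `½∂ᴴ∂x = Σ_μ ∇_μ* Φ_μ`, `Φ_μ(s,κ) = F_{μκ}(x)(s)` (§2).
THE ARGUMENT.  (§1) For every `x`: `Q_k(x − ∂λ₀) = Q_kx` ((1.20) `QvOp_GradOp_mulVec` + `QsOp_lambda0`), `∂ᵛ(x − ∂λ₀) = ∂ᵛx`, `∂*(x − ∂λ₀) = P∂*x`
(`residual_lambda0`), so `(1 − P)∂*x₂ = 0` (`PcT_mulVec_idem`); for `Q_kx = 0`: `Δ_1x₂ = ½∂ᴴ∂x₂ + ∂(1−P)∂*x₂ + Q*Q x₂ = ½∂ᴴ∂x =: J` (`DeltaA_eq_curl`), hence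
`x₂ = Δ_1⁻¹J` (`solution_eq`) — G1's §4, now with the representative itself exposed.  (§2) `J = Σ_μ ∇_μ*Φ_μ` by the antisymmetry of `F`.  (§3) SUP:
`|x₂(i)| ≤ Σ_μ |Δ_1⁻¹∇_μ*Φ_μ(i)| ≤ (d+1)·C₃(d)·sup|F|`.  (§4) `|∇_νx₂| ≤ C₂|J|_∞`, `|Δx₂| ≤ C₄|J|_∞` (GAN24 entries 2, 4), `|x₂| ≤ C₁|J|_∞` (lit-balaban's first
entry `B5G115SupBound.norm_DeltaA_one_inv_mulVec_le_global`), and `∂∂*x₂ = Δx₂ − ½∂ᴴ∂x` (`curl_adjoint_curl`: `∂ᴴ∂ = 2(Δ − ∂∂*)`) so `|∂∂*x₂| ≤ (C₄+1)|J|_∞` —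
the (1.39) pair.  (§5) ONE packaged END `exists_landauLinear`.
T4 CURRENCY (for the successor; not used here).  With lattice factor `c = n = M`: `F = n·(plaquette sum)`, so at plaquette radius `δ∕M²` the sup letter reads
`sup|x₂| ≤ C·M·δ∕M² = Cδ∕M` — the `r₀` scale of REP♭⁻; `J = n²·(lattice current)`, so at a tangent-critical point (current `≲ δ∕M³`, R1–R4) the gradient letter
gives link differences `≲ δ∕M²` — the `r₁` scale — and `|∂∂*x₂|` the `∇div`-reaction `≲ δ∕M³` that t4-ne7-p2's (159) `hdiv` asks.
WHAT ([folklore]; 0 def, 0 sorry; dimension `d + 1 ≥ 1`, every `n ≥ 1`, every period vector `M`).  §1 `QvOp_landau`, `CurlOp_landau`, `Fs_landau`, `div_landau`,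
`residual_landau`, `DeltaA_landau`, `landau_eq_inv`; §2 `fdiff_entry`, `CurlOp_entry`, `curlAdj_mulVec_apply`, `curlAdjCurl_apply`, `fdiffH_plaq_apply`, `half_curlAdjCurl_eq_sum_fdiffH`; §3
**`exists_sup_const`**; §4 `exists_grad_const`, `exists_lap_const`, `exists_source_const`, `gradDiv_landau_eq`, `exists_gradDiv_const`; §5 **`exists_landauLinear`**.
HONEST FRAMING (page 1): the LINEAR (abelian, `U₀ = 1`-chart) letter only — a composition of tree theorems BY NAME; constants existential through GAN24's `C(d)`
and lit-balaban's decay constants (functions of `d` only), NOT printed `O(1)`'s; [B5] (1.110)∕(1.115) pp. 35–36 and [B8] (1.36)∕(1.39) p. 83 are TEXT LOCATIONS,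
nothing printed is asserted.  The NONLINEAR REP♭ (nonabelian, `k+1` levels: [B8] Thm 4's induction p. 88) is NOT proved; (APE) at the trivial flat datum stays
conditional on it; NOT ONE-STEP, NOT NE7; spine 0∕9; finite T⁴ rung (B)+1 — NOT infinite volume, NOT mass gap, NOT BetaPertH, NOT Clay.  Continuum YM on T⁴ ⇐
BetaPertH ∧ nine spine estimates (0/9 proved); BetaPertH ⇐ (D1) ∧ (D4) ∧ CAP+tail; G-an2-4 gates asym, D1 and NE2/3/4.
-/

set_option autoImplicit false

open scoped BigOperators Matrix ComplexConjugate
open Finset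

namespace Summit.QuantumFields.BalabanUV.T4Continuum.NE7LandauLinearSup

open Literature.MathematicalPhysics.QuantumFieldTheory.Balaban1983to89
open B5Prop11Plancherel (Tor fine fdiff unitVec shiftM)
open B5Action121 (Fs GradOp CurlOp CurlOp_mulVec LapV curl_adjoint_curl Lap_eq_LapV GradOp_conjTranspose_mul_GradOp)
open B5Block118 (QvOp QsOp)
open B5Prop11Lower (Lap)
open B5DeltaA169 (DeltaA DeltaA_eq_curl solution_eq calG_eq_DeltaA_inv)
open B5Value126 (PcT lambda0 residual_lambda0 QsOp_lambda0 PcT_mulVec_idem sum_lambda0)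
open B5Hk160Torus (QvOp_GradOp_mulVec)
open B5DivOrth (sum_GradOp_adjoint)
open B5G183FreeRowSum (fdiff_conjTranspose_mulVec)
open B5G183Strip (kappa183 kappa183_pos)
open B5G183CovDecay (MD183 MD183_nonneg)
open B4TorusKernel (periodConst)
open B4Sect5Proof (latticeConst latticeConst_nonneg)
open B5Kernel166Decay (periodConst_pos)
open B5G115SupBound (norm_DeltaA_one_inv_mulVec_le_global)
open Beta.GAN24.Entry110Rect (norm_fdiff_inv_mulVec_le norm_inv_fdiffH_mulVec_le norm_Lap_inv_mulVec_le)
open NE7SliceGreenTorus (CurlOp_mulVec_GradOp)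

noncomputable section

variable {d : ℕ}

/-! ## §1 The restricted Landau transform `x₂ = x − ∂λ₀(∂*x)`: identities -/

section Gauge

variable (n : ℕ) [NeZero n] (M : Fin (d + 1) → ℕ) [∀ μ, NeZero (M μ)]

/-- the block average is unchanged: `Q_k(x − ∂λ₀(∂*x)) = Q_kx` ((1.20) and `Q′_kλ₀ = 0`). [folklore] -/
theorem QvOp_landau (x : Tor (fine n M) × Fin (d + 1) → ℂ) :
    QvOp n M *ᵥ (x - GradOp (fine n M) (n : ℂ) *ᵥ lambda0 n M (n : ℂ) ((GradOp (fine n M) (n : ℂ))ᴴ *ᵥ x))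
      = QvOp n M *ᵥ x := by
  have hc : (n : ℂ) ≠ 0 := by exact_mod_cast NeZero.ne n
  rw [Matrix.mulVec_sub, QvOp_GradOp_mulVec, QsOp_lambda0 n M (n : ℂ) hc, Matrix.mulVec_zero, sub_zero]

/-- the curl is unchanged: `∂ᵛ(x − ∂λ₀(∂*x)) = ∂ᵛx`. [folklore] -/
theorem CurlOp_landau (x : Tor (fine n M) × Fin (d + 1) → ℂ) :
    CurlOp (fine n M) (n : ℂ) *ᵥ (x - GradOp (fine n M) (n : ℂ) *ᵥ lambda0 n M (n : ℂ) ((GradOp (fine n M) (n : ℂ))ᴴ *ᵥ x))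
      = CurlOp (fine n M) (n : ℂ) *ᵥ x := by
  rw [Matrix.mulVec_sub, CurlOp_mulVec_GradOp, sub_zero]

/-- the plaquette field is unchanged, componentwise. [folklore] -/
theorem Fs_landau (x : Tor (fine n M) × Fin (d + 1) → ℂ) (μ ν : Fin (d + 1)) (t : Tor (fine n M)) :
    Fs (fine n M) (n : ℂ) (x - GradOp (fine n M) (n : ℂ) *ᵥ lambda0 n M (n : ℂ) ((GradOp (fine n M) (n : ℂ))ᴴ *ᵥ x)) μ ν t
      = Fs (fine n M) (n : ℂ) x μ ν t := by
  rw [← CurlOp_mulVec, ← CurlOp_mulVec, CurlOp_landau]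

/-- the divergence becomes the non-removable part: `∂*(x − ∂λ₀(∂*x)) = P∂*x` (B5 (1.26), `residual_lambda0`). [cite: Balaban1984PropagatorsI, (1.26) p.22 (text location; composition ours)] -/
theorem div_landau (x : Tor (fine n M) × Fin (d + 1) → ℂ) :
    (GradOp (fine n M) (n : ℂ))ᴴ *ᵥ (x - GradOp (fine n M) (n : ℂ) *ᵥ lambda0 n M (n : ℂ) ((GradOp (fine n M) (n : ℂ))ᴴ *ᵥ x))
      = PcT n M (n : ℂ) *ᵥ ((GradOp (fine n M) (n : ℂ))ᴴ *ᵥ x) := by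
  have hc : (n : ℂ) ≠ 0 := by exact_mod_cast NeZero.ne n
  rw [Matrix.mulVec_sub, Matrix.mulVec_mulVec, GradOp_conjTranspose_mul_GradOp]
  exact residual_lambda0 n M (n : ℂ) hc _ (sum_GradOp_adjoint (fine n M) (n : ℂ) x)

/-- **Bałaban's gauge condition** `(1 − P)∂*x₂ = 0` for `x₂ = x − ∂λ₀(∂*x)` ([B8] (1.38) at `U₀ = 1` in the linear chart). [cite: Balaban1985RegularSpaces, (1.38) p.83 (text location; composition ours)] -/
theorem residual_landau (x : Tor (fine n M) × Fin (d + 1) → ℂ) :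
    (1 - PcT n M (n : ℂ)) *ᵥ ((GradOp (fine n M) (n : ℂ))ᴴ *ᵥ
        (x - GradOp (fine n M) (n : ℂ) *ᵥ lambda0 n M (n : ℂ) ((GradOp (fine n M) (n : ℂ))ᴴ *ᵥ x))) = 0 := by
  have hc : (n : ℂ) ≠ 0 := by exact_mod_cast NeZero.ne n
  rw [div_landau, Matrix.sub_mulVec, Matrix.one_mulVec, PcT_mulVec_idem n M (n : ℂ) hc, sub_self]

/-- for `Q_kx = 0`: `Δ_1x₂ = ½∂ᴴ∂x` (`Δ_1 = ½∂ᴴ∂ + ∂(1−P)∂* + Q*Q`, (1.69)). [cite: Balaban1984PropagatorsI, (1.69) p.29 (text location; composition ours)] -/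
theorem DeltaA_landau (x : Tor (fine n M) × Fin (d + 1) → ℂ) (hx : QvOp n M *ᵥ x = 0) :
    DeltaA n M 1 *ᵥ (x - GradOp (fine n M) (n : ℂ) *ᵥ lambda0 n M (n : ℂ) ((GradOp (fine n M) (n : ℂ))ᴴ *ᵥ x))
      = (1 / 2 : ℂ) • (((CurlOp (fine n M) (n : ℂ))ᴴ * CurlOp (fine n M) (n : ℂ)) *ᵥ x) := by
  have hQ : QvOp n M *ᵥ (x - GradOp (fine n M) (n : ℂ) *ᵥ lambda0 n M (n : ℂ) ((GradOp (fine n M) (n : ℂ))ᴴ *ᵥ x)) = 0 := by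
    rw [QvOp_landau, hx]
  rw [DeltaA_eq_curl n M (1 : ℝ)]
  simp only [Matrix.add_mulVec, Matrix.smul_mulVec, ← Matrix.mulVec_mulVec]
  rw [residual_landau, Matrix.mulVec_zero, add_zero, hQ, Matrix.mulVec_zero, smul_zero, add_zero, CurlOp_landau]

/-- for `Q_kx = 0`: **`x₂ = Δ_1⁻¹(½∂ᴴ∂x)`** — the Feynman-gauge representative of G1, exposed. [folklore] -/
theorem landau_eq_inv (x : Tor (fine n M) × Fin (d + 1) → ℂ) (hx : QvOp n M *ᵥ x = 0) :
    x - GradOp (fine n M) (n : ℂ) *ᵥ lambda0 n M (n : ℂ) ((GradOp (fine n M) (n : ℂ))ᴴ *ᵥ x)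
      = (DeltaA n M 1)⁻¹ *ᵥ ((1 / 2 : ℂ) • (((CurlOp (fine n M) (n : ℂ))ᴴ * CurlOp (fine n M) (n : ℂ)) *ᵥ x)) := by
  have hn1 : 1 ≤ n := Nat.one_le_iff_ne_zero.mpr (NeZero.ne n)
  rw [← calG_eq_DeltaA_inv n hn1 M 1 one_pos]
  exact solution_eq n hn1 M 1 one_pos (DeltaA_landau n M x hx)

end Gauge

/-! ## §2 The source `½∂ᴴ∂x` is a divergence of the plaquette field: `½∂ᴴ∂x = Σ_μ ∇_μ*Φ_μ`, `Φ_μ(s,κ) = F_{μκ}(x)(s)` -/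

section Source

variable (n : ℕ) [NeZero n] (M : Fin (d + 1) → ℕ) [∀ μ, NeZero (M μ)]

omit [NeZero n] [∀ μ, NeZero (M μ)] in
/-- the entries of the componentwise difference: `(∇_μ)_{(t,ν),(s,κ)} = [ν = κ]·(∂_μ)_{t,s}`. [folklore] -/
theorem fdiff_entry (μ : Fin (d + 1)) (t s : Tor (fine n M)) (ν κ : Fin (d + 1)) :
    fdiff (fine n M) (n : ℂ) μ (t, ν) (s, κ) = if ν = κ then B5Action121.sdiff (fine n M) (n : ℂ) μ t s else 0 := by
  simp only [fdiff, shiftM, B5Action121.sdiff, B5Action121.shiftS, Matrix.smul_apply, Matrix.sub_apply, Matrix.one_apply,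
    Prod.mk.injEq, smul_eq_mul]
  by_cases h : ν = κ
  · subst h
    simp
  · simp [h, Ne.symm h]

omit [NeZero n] [∀ μ, NeZero (M μ)] in
/-- the entries of the ordered-pair curl: `∂ᵛ_{(t,(μ,ν)),(s,κ)} = [κ = ν](∂_μ)_{t,s} − [κ = μ](∂_ν)_{t,s}`. [folklore] -/
theorem CurlOp_entry (t s : Tor (fine n M)) (μ ν κ : Fin (d + 1)) :
    CurlOp (fine n M) (n : ℂ) (t, (μ, ν)) (s, κ)
      = (if κ = ν then B5Action121.sdiff (fine n M) (n : ℂ) μ t s else 0)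
        - (if κ = μ then B5Action121.sdiff (fine n M) (n : ℂ) ν t s else 0) := rfl

/-- the adjoint curl (lattice co-differential on ordered pairs), pointwise: `(∂ᵛᴴG)(s,κ) = Σ_μ Σ_t conj((∂_μ)_{t,s})·(G(t,(μ,κ)) − G(t,(κ,μ)))`. [folklore] -/
theorem curlAdj_mulVec_apply (G : Tor (fine n M) × (Fin (d + 1) × Fin (d + 1)) → ℂ) (s : Tor (fine n M)) (κ : Fin (d + 1)) :
    ((CurlOp (fine n M) (n : ℂ))ᴴ *ᵥ G) (s, κ)
      = ∑ μ, ∑ t, star (B5Action121.sdiff (fine n M) (n : ℂ) μ t s) * (G (t, (μ, κ)) - G (t, (κ, μ))) := by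
  have hmv : ((CurlOp (fine n M) (n : ℂ))ᴴ *ᵥ G) (s, κ) = ∑ p, star (CurlOp (fine n M) (n : ℂ) p (s, κ)) * G p := rfl
  rw [hmv, Fintype.sum_prod_type]
  simp only [Fintype.sum_prod_type, CurlOp_entry, star_sub, sub_mul, Finset.sum_sub_distrib, apply_ite star, star_zero,
    ite_mul, zero_mul]
  -- first block
  have h1 : ∑ t : Tor (fine n M), ∑ μ : Fin (d + 1), ∑ ν : Fin (d + 1),
      (if κ = ν then star (B5Action121.sdiff (fine n M) (n : ℂ) μ t s) * G (t, (μ, ν)) else 0)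
      = ∑ μ, ∑ t, star (B5Action121.sdiff (fine n M) (n : ℂ) μ t s) * G (t, (μ, κ)) := by
    rw [Finset.sum_comm]
    refine Finset.sum_congr rfl fun μ _ => Finset.sum_congr rfl fun t _ => ?_
    rw [Finset.sum_ite_eq, if_pos (Finset.mem_univ κ)]
  -- second block
  have h2 : ∑ t : Tor (fine n M), ∑ μ : Fin (d + 1), ∑ ν : Fin (d + 1),
      (if κ = μ then star (B5Action121.sdiff (fine n M) (n : ℂ) ν t s) * G (t, (μ, ν)) else 0)
      = ∑ μ, ∑ t, star (B5Action121.sdiff (fine n M) (n : ℂ) μ t s) * G (t, (κ, μ)) := by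
    have h2' : ∀ t : Tor (fine n M), ∑ μ : Fin (d + 1), ∑ ν : Fin (d + 1),
        (if κ = μ then star (B5Action121.sdiff (fine n M) (n : ℂ) ν t s) * G (t, (μ, ν)) else 0)
        = ∑ ν, star (B5Action121.sdiff (fine n M) (n : ℂ) ν t s) * G (t, (κ, ν)) := by
      intro t
      rw [Finset.sum_comm]
      refine Finset.sum_congr rfl fun ν _ => ?_
      rw [Finset.sum_ite_eq, if_pos (Finset.mem_univ κ)]
    simp_rw [h2']
    rw [Finset.sum_comm]
  rw [h1, h2, ← Finset.sum_sub_distrib]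
  refine Finset.sum_congr rfl fun μ _ => ?_
  rw [← Finset.sum_sub_distrib]
  refine Finset.sum_congr rfl fun t _ => ?_
  ring

/-- `(∂ᴴ∂x)(s,κ) = 2 Σ_μ Σ_t conj((∂_μ)_{t,s}) F_{μκ}(x)(t)` (antisymmetry of `F`). [folklore] -/
theorem curlAdjCurl_apply (x : Tor (fine n M) × Fin (d + 1) → ℂ) (s : Tor (fine n M)) (κ : Fin (d + 1)) :
    (((CurlOp (fine n M) (n : ℂ))ᴴ * CurlOp (fine n M) (n : ℂ)) *ᵥ x) (s, κ)
      = 2 * ∑ μ, ∑ t, star (B5Action121.sdiff (fine n M) (n : ℂ) μ t s) * Fs (fine n M) (n : ℂ) x μ κ t := by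
  have hanti : ∀ (μ : Fin (d + 1)) (t : Tor (fine n M)), Fs (fine n M) (n : ℂ) x κ μ t = -Fs (fine n M) (n : ℂ) x μ κ t := by
    intro μ t
    simp only [Fs]
    ring
  rw [← Matrix.mulVec_mulVec, curlAdj_mulVec_apply, Finset.mul_sum]
  refine Finset.sum_congr rfl fun μ _ => ?_
  rw [Finset.mul_sum]
  refine Finset.sum_congr rfl fun t _ => ?_
  rw [CurlOp_mulVec, CurlOp_mulVec, hanti μ t]
  ring

/-- `(∇_μ*Φ_μ)(s,κ) = Σ_t conj((∂_μ)_{t,s}) F_{μκ}(x)(t)` for `Φ_μ(t,ν) = F_{μν}(x)(t)`. [folklore] -/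
theorem fdiffH_plaq_apply (x : Tor (fine n M) × Fin (d + 1) → ℂ) (μ : Fin (d + 1)) (s : Tor (fine n M)) (κ : Fin (d + 1)) :
    ((fdiff (fine n M) (n : ℂ) μ)ᴴ *ᵥ (fun j : Tor (fine n M) × Fin (d + 1) => Fs (fine n M) (n : ℂ) x μ j.2 j.1)) (s, κ)
      = ∑ t, star (B5Action121.sdiff (fine n M) (n : ℂ) μ t s) * Fs (fine n M) (n : ℂ) x μ κ t := by
  have hmv : ((fdiff (fine n M) (n : ℂ) μ)ᴴ *ᵥ (fun j : Tor (fine n M) × Fin (d + 1) => Fs (fine n M) (n : ℂ) x μ j.2 j.1)) (s, κ)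
      = ∑ p : Tor (fine n M) × Fin (d + 1), star (fdiff (fine n M) (n : ℂ) μ p (s, κ)) * Fs (fine n M) (n : ℂ) x μ p.2 p.1 := rfl
  rw [hmv, Fintype.sum_prod_type]
  refine Finset.sum_congr rfl fun t _ => ?_
  simp only [fdiff_entry, apply_ite star, star_zero, ite_mul, zero_mul]
  rw [Finset.sum_ite_eq', if_pos (Finset.mem_univ κ)]

/-- **THE SOURCE IS A DIVERGENCE OF THE PLAQUETTE FIELD**: `½∂ᴴ∂x = Σ_μ ∇_μ*Φ_μ`, `Φ_μ(t,ν) = F_{μν}(x)(t)` (the lattice form of `∂*F = Σ_μ∇_μ*F_{μ·}`). [folklore] -/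
theorem half_curlAdjCurl_eq_sum_fdiffH (x : Tor (fine n M) × Fin (d + 1) → ℂ) :
    (1 / 2 : ℂ) • (((CurlOp (fine n M) (n : ℂ))ᴴ * CurlOp (fine n M) (n : ℂ)) *ᵥ x)
      = ∑ μ, (fdiff (fine n M) (n : ℂ) μ)ᴴ *ᵥ (fun j : Tor (fine n M) × Fin (d + 1) => Fs (fine n M) (n : ℂ) x μ j.2 j.1) := by
  funext i
  obtain ⟨s, κ⟩ := i
  rw [Pi.smul_apply, curlAdjCurl_apply, Finset.sum_apply]
  simp_rw [fdiffH_plaq_apply]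
  rw [smul_eq_mul]
  ring

end Source

/-! ## §3 THE SUP LETTER: `|x₂| ≤ (d+1)·C₃(d)·sup|F(x)|`, every spacing, every torus -/

/-- **THE SUP LETTER OF THE LINEAR LANDAU REPRESENTATIVE** (dimension `d + 1`): there is `C > 0` depending on `d` only such that for EVERY `n ≥ 1`, EVERY period
vector `M`, every vector field `x` with `Q_kx = 0` and every `B` with `|F_{μν}(x)(t)| ≤ B` for all `μ ν t`:  `|x₂(i)| ≤ C·B` at every bond `i`, where
`x₂ = x − ∂λ₀(∂*x)`.  (`C = (d+1)·C₃(d)`, `C₃` = GAN24's third-entry constant; [B8] (1.36)₁ in the linear chart at `U₀ = 1`: `|A| < B₁α₀` from `|F| < α₀`.) [folklore] -/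
theorem exists_sup_const :
    ∃ C : ℝ, 0 < C ∧ ∀ (n : ℕ) [NeZero n] (M : Fin (d + 1) → ℕ) [∀ μ, NeZero (M μ)]
      (x : Tor (fine n M) × Fin (d + 1) → ℂ), QvOp n M *ᵥ x = 0 → ∀ B : ℝ,
      (∀ (μ ν : Fin (d + 1)) (t : Tor (fine n M)), ‖Fs (fine n M) (n : ℂ) x μ ν t‖ ≤ B) →
      ∀ i : Tor (fine n M) × Fin (d + 1),
        ‖(x - GradOp (fine n M) (n : ℂ) *ᵥ lambda0 n M (n : ℂ) ((GradOp (fine n M) (n : ℂ))ᴴ *ᵥ x)) i‖ ≤ C * B := by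
  obtain ⟨C₃, hC₃, h3⟩ := norm_inv_fdiffH_mulVec_le (d := d)
  refine ⟨((d + 1 : ℕ) : ℝ) * C₃, by positivity, fun n _ M _ x hx B hB i => ?_⟩
  rw [landau_eq_inv n M x hx, half_curlAdjCurl_eq_sum_fdiffH, Matrix.mulVec_sum, Finset.sum_apply]
  calc ‖∑ μ, ((DeltaA n M 1)⁻¹ *ᵥ ((fdiff (fine n M) (n : ℂ) μ)ᴴ *ᵥ
            (fun j : Tor (fine n M) × Fin (d + 1) => Fs (fine n M) (n : ℂ) x μ j.2 j.1))) i‖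
      ≤ ∑ μ : Fin (d + 1), ‖((DeltaA n M 1)⁻¹ *ᵥ ((fdiff (fine n M) (n : ℂ) μ)ᴴ *ᵥ
            (fun j : Tor (fine n M) × Fin (d + 1) => Fs (fine n M) (n : ℂ) x μ j.2 j.1))) i‖ := norm_sum_le _ _
    _ ≤ ∑ _μ : Fin (d + 1), C₃ * B := Finset.sum_le_sum fun μ _ => h3 n M μ _ B (fun j => hB μ j.2 j.1) i
    _ = ((d + 1 : ℕ) : ℝ) * C₃ * B := by rw [Finset.sum_const, Finset.card_univ, Fintype.card_fin, nsmul_eq_mul]; ring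

/-! ## §4 THE GRADIENT, LAPLACIAN, SOURCE AND `∂∂*` LETTERS from the sup of the source `J = ½∂ᴴ∂x` -/

/-- **GRADIENT LETTER**: `∃ C(d) > 0`, for every `n, M`, `x ∈ ker Q_k`, `B′` with `|J| ≤ B′` (`J = ½∂ᴴ∂x`), every direction `ν` and bond `i`:
`|(∇_νx₂)(i)| ≤ C·B′` (GAN24's second entry; [B8] (1.36)₂ in the linear chart, the current in place of (1.9)). [folklore] -/
theorem exists_grad_const :
    ∃ C : ℝ, 0 < C ∧ ∀ (n : ℕ) [NeZero n] (M : Fin (d + 1) → ℕ) [∀ μ, NeZero (M μ)]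
      (x : Tor (fine n M) × Fin (d + 1) → ℂ), QvOp n M *ᵥ x = 0 → ∀ B' : ℝ,
      (∀ j, ‖((1 / 2 : ℂ) • (((CurlOp (fine n M) (n : ℂ))ᴴ * CurlOp (fine n M) (n : ℂ)) *ᵥ x)) j‖ ≤ B') →
      ∀ (ν : Fin (d + 1)) (i : Tor (fine n M) × Fin (d + 1)),
        ‖(fdiff (fine n M) (n : ℂ) ν *ᵥ
            (x - GradOp (fine n M) (n : ℂ) *ᵥ lambda0 n M (n : ℂ) ((GradOp (fine n M) (n : ℂ))ᴴ *ᵥ x))) i‖ ≤ C * B' := by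
  obtain ⟨C₂, hC₂, h2⟩ := norm_fdiff_inv_mulVec_le (d := d)
  refine ⟨C₂, hC₂, fun n _ M _ x hx B' hB ν i => ?_⟩
  rw [landau_eq_inv n M x hx]
  exact h2 n M ν _ B' hB i

/-- **LAPLACIAN LETTER**: `|(Δx₂)(i)| ≤ C(d)·B′` under `|J| ≤ B′` (GAN24's fourth entry; the `Δ`-half of [B8] (1.39) in the linear chart). [folklore] -/
theorem exists_lap_const :
    ∃ C : ℝ, 0 < C ∧ ∀ (n : ℕ) [NeZero n] (M : Fin (d + 1) → ℕ) [∀ μ, NeZero (M μ)]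
      (x : Tor (fine n M) × Fin (d + 1) → ℂ), QvOp n M *ᵥ x = 0 → ∀ B' : ℝ,
      (∀ j, ‖((1 / 2 : ℂ) • (((CurlOp (fine n M) (n : ℂ))ᴴ * CurlOp (fine n M) (n : ℂ)) *ᵥ x)) j‖ ≤ B') →
      ∀ i : Tor (fine n M) × Fin (d + 1),
        ‖(Lap n M *ᵥ (x - GradOp (fine n M) (n : ℂ) *ᵥ lambda0 n M (n : ℂ) ((GradOp (fine n M) (n : ℂ))ᴴ *ᵥ x))) i‖ ≤ C * B' := by
  obtain ⟨C₄, hC₄, h4⟩ := norm_Lap_inv_mulVec_le (d := d)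
  refine ⟨C₄, hC₄, fun n _ M _ x hx B' hB i => ?_⟩
  rw [landau_eq_inv n M x hx]
  exact h4 n M _ B' hB i

/-- **SOURCE LETTER** (lit-balaban's first entry of (1.115), `B5G115SupBound`, splitting order `d`): `|x₂(i)| ≤ C(d)·B′` under `|J| ≤ B′` — the sup bound
from the CURRENT (useful at a critical point, where `J` is small), beside §3's bound from the curvature. [folklore] -/
theorem exists_source_const :
    ∃ C : ℝ, 0 < C ∧ ∀ (n : ℕ) [NeZero n] (M : Fin (d + 1) → ℕ) [∀ μ, NeZero (M μ)]
      (x : Tor (fine n M) × Fin (d + 1) → ℂ), QvOp n M *ᵥ x = 0 → ∀ B' : ℝ,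
      (∀ j, ‖((1 / 2 : ℂ) • (((CurlOp (fine n M) (n : ℂ))ᴴ * CurlOp (fine n M) (n : ℂ)) *ᵥ x)) j‖ ≤ B') →
      ∀ i : Tor (fine n M) × Fin (d + 1),
        ‖(x - GradOp (fine n M) (n : ℂ) *ᵥ lambda0 n M (n : ℂ) ((GradOp (fine n M) (n : ℂ))ᴴ *ᵥ x)) i‖ ≤ C * B' := by
  have hκ : 0 < kappa183 (d + 1) / (d + 1) := div_pos (kappa183_pos (d + 1)) (by positivity)
  set K : ℝ := 2 * d * 2 ^ d * Real.exp (1 / (2 * (d + 1))) * latticeConst (d + 1) (1 / (2 * (d + 1)))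
      + (d + 1) * (MD183 (d + 1) d * periodConst (kappa183 (d + 1)) d * latticeConst (d + 1) (kappa183 (d + 1) / (d + 1))) with hK
  have hK0 : 0 ≤ K := by
    have h1 : 0 ≤ latticeConst (d + 1) (1 / (2 * ((d : ℝ) + 1))) := latticeConst_nonneg _ (by positivity)
    have h2 : 0 ≤ latticeConst (d + 1) (kappa183 (d + 1) / (d + 1)) := latticeConst_nonneg _ hκ.le
    have h3 : 0 ≤ MD183 (d + 1) d := MD183_nonneg _ _
    have h4 : 0 ≤ periodConst (kappa183 (d + 1)) d := (periodConst_pos (kappa183_pos (d + 1)) d).le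
    positivity
  refine ⟨K + 1, by positivity, fun n _ M _ x hx B' hB i => ?_⟩
  have hn1 : 1 ≤ n := Nat.one_le_iff_ne_zero.mpr (NeZero.ne n)
  have hB0 : 0 ≤ B' := (norm_nonneg _).trans (hB i)
  rw [landau_eq_inv n M x hx]
  calc _ ≤ B' * K := norm_DeltaA_one_inv_mulVec_le_global n hn1 M (Nn := d) le_rfl _ hB i
    _ ≤ (K + 1) * B' := by nlinarith

section GradDiv

variable (n : ℕ) [NeZero n] (M : Fin (d + 1) → ℕ) [∀ μ, NeZero (M μ)]

/-- `∂∂*x₂ = Δx₂ − ½∂ᴴ∂x` (`∂ᴴ∂ = 2(Δ − ∂∂*)` on vector fields, `curl_adjoint_curl`; the curl of `x₂` is that of `x`). [folklore] -/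
theorem gradDiv_landau_eq (x : Tor (fine n M) × Fin (d + 1) → ℂ) :
    GradOp (fine n M) (n : ℂ) *ᵥ ((GradOp (fine n M) (n : ℂ))ᴴ *ᵥ
        (x - GradOp (fine n M) (n : ℂ) *ᵥ lambda0 n M (n : ℂ) ((GradOp (fine n M) (n : ℂ))ᴴ *ᵥ x)))
      = Lap n M *ᵥ (x - GradOp (fine n M) (n : ℂ) *ᵥ lambda0 n M (n : ℂ) ((GradOp (fine n M) (n : ℂ))ᴴ *ᵥ x))
        - (1 / 2 : ℂ) • (((CurlOp (fine n M) (n : ℂ))ᴴ * CurlOp (fine n M) (n : ℂ)) *ᵥ x) := by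
  set x₂ := x - GradOp (fine n M) (n : ℂ) *ᵥ lambda0 n M (n : ℂ) ((GradOp (fine n M) (n : ℂ))ᴴ *ᵥ x) with hx₂
  have hcurl : ((CurlOp (fine n M) (n : ℂ))ᴴ * CurlOp (fine n M) (n : ℂ)) *ᵥ x
      = ((CurlOp (fine n M) (n : ℂ))ᴴ * CurlOp (fine n M) (n : ℂ)) *ᵥ x₂ := by
    rw [← Matrix.mulVec_mulVec, ← Matrix.mulVec_mulVec, hx₂, CurlOp_landau]
  have hop : ((CurlOp (fine n M) (n : ℂ))ᴴ * CurlOp (fine n M) (n : ℂ)) *ᵥ x₂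
      = (2 : ℂ) • (Lap n M *ᵥ x₂ - GradOp (fine n M) (n : ℂ) *ᵥ ((GradOp (fine n M) (n : ℂ))ᴴ *ᵥ x₂)) := by
    rw [curl_adjoint_curl, Matrix.smul_mulVec, Matrix.sub_mulVec, Lap_eq_LapV, ← Matrix.mulVec_mulVec]
  rw [hcurl, hop, smul_smul]
  norm_num

end GradDiv

/-- **`∂∂*` LETTER**: `|(∂∂*x₂)(i)| ≤ C(d)·B′` under `|J| ≤ B′` — with the Laplacian letter, the (1.39) pair of [B8] in the linear chart; in T4 currency this is
the `∇div` reaction `≲ δ∕M³` (hypothesis `hdiv` of t4-ne7-p2's (159)). [folklore] -/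
theorem exists_gradDiv_const :
    ∃ C : ℝ, 0 < C ∧ ∀ (n : ℕ) [NeZero n] (M : Fin (d + 1) → ℕ) [∀ μ, NeZero (M μ)]
      (x : Tor (fine n M) × Fin (d + 1) → ℂ), QvOp n M *ᵥ x = 0 → ∀ B' : ℝ,
      (∀ j, ‖((1 / 2 : ℂ) • (((CurlOp (fine n M) (n : ℂ))ᴴ * CurlOp (fine n M) (n : ℂ)) *ᵥ x)) j‖ ≤ B') →
      ∀ i : Tor (fine n M) × Fin (d + 1),
        ‖(GradOp (fine n M) (n : ℂ) *ᵥ ((GradOp (fine n M) (n : ℂ))ᴴ *ᵥ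
            (x - GradOp (fine n M) (n : ℂ) *ᵥ lambda0 n M (n : ℂ) ((GradOp (fine n M) (n : ℂ))ᴴ *ᵥ x)))) i‖ ≤ C * B' := by
  obtain ⟨C₄, hC₄, h4⟩ := exists_lap_const (d := d)
  refine ⟨C₄ + 1, by positivity, fun n _ M _ x hx B' hB i => ?_⟩
  rw [gradDiv_landau_eq, Pi.sub_apply]
  calc _ ≤ ‖(Lap n M *ᵥ (x - GradOp (fine n M) (n : ℂ) *ᵥ lambda0 n M (n : ℂ) ((GradOp (fine n M) (n : ℂ))ᴴ *ᵥ x))) i‖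
        + ‖((1 / 2 : ℂ) • (((CurlOp (fine n M) (n : ℂ))ᴴ * CurlOp (fine n M) (n : ℂ)) *ᵥ x)) i‖ := norm_sub_le _ _
    _ ≤ C₄ * B' + B' := add_le_add (h4 n M x hx B' hB i) (hB i)
    _ = (C₄ + 1) * B' := by ring

/-! ## §5 THE END: one packaged statement -/

/-- **THE LINEAR LANDAU LETTER OF REP♭ AT `U₀ = 1`, `k`- AND `N`-UNIFORM** (dimension `d + 1`): there is ONE constant `C > 0` depending on `d` only such that
for EVERY `n ≥ 1`, EVERY period vector `M` and every vector field `x` with `Q_kx = 0`, the restricted Landau transform `x₂ := x − ∂λ₀(∂*x)` (gauge function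
`λ₀` with `Q′_kλ₀ = 0`, `Σλ₀ = 0`) satisfies: `Q_kx₂ = 0`; `(1 − P)∂*x₂ = 0`; `∂ᵛx₂ = ∂ᵛx`; for every `B` bounding `|F(x)|`: `|x₂| ≤ C·B`; for every `B′` bounding
`|½∂ᴴ∂x|`: `|x₂| ≤ C·B′`, `|∇_νx₂| ≤ C·B′`, `|Δx₂| ≤ C·B′`, `|∂∂*x₂| ≤ C·B′`.  ([B8] Thm 2's (1.36)₁,₂ ∕ (1.38) ∕ (1.39) in the LINEAR chart at the trivial
background — the engine of each level of the nonlinear REP♭, which is NOT proved here.) [folklore] -/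
theorem exists_landauLinear :
    ∃ C : ℝ, 0 < C ∧ ∀ (n : ℕ) [NeZero n] (M : Fin (d + 1) → ℕ) [∀ μ, NeZero (M μ)]
      (x : Tor (fine n M) × Fin (d + 1) → ℂ), QvOp n M *ᵥ x = 0 →
      QsOp n M *ᵥ lambda0 n M (n : ℂ) ((GradOp (fine n M) (n : ℂ))ᴴ *ᵥ x) = 0 ∧
      ∑ s, lambda0 n M (n : ℂ) ((GradOp (fine n M) (n : ℂ))ᴴ *ᵥ x) s = 0 ∧
      QvOp n M *ᵥ (x - GradOp (fine n M) (n : ℂ) *ᵥ lambda0 n M (n : ℂ) ((GradOp (fine n M) (n : ℂ))ᴴ *ᵥ x)) = 0 ∧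
      (1 - PcT n M (n : ℂ)) *ᵥ ((GradOp (fine n M) (n : ℂ))ᴴ *ᵥ
        (x - GradOp (fine n M) (n : ℂ) *ᵥ lambda0 n M (n : ℂ) ((GradOp (fine n M) (n : ℂ))ᴴ *ᵥ x))) = 0 ∧
      CurlOp (fine n M) (n : ℂ) *ᵥ (x - GradOp (fine n M) (n : ℂ) *ᵥ lambda0 n M (n : ℂ) ((GradOp (fine n M) (n : ℂ))ᴴ *ᵥ x))
        = CurlOp (fine n M) (n : ℂ) *ᵥ x ∧
      (∀ B : ℝ, (∀ (μ ν : Fin (d + 1)) (t : Tor (fine n M)), ‖Fs (fine n M) (n : ℂ) x μ ν t‖ ≤ B) →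
        ∀ i, ‖(x - GradOp (fine n M) (n : ℂ) *ᵥ lambda0 n M (n : ℂ) ((GradOp (fine n M) (n : ℂ))ᴴ *ᵥ x)) i‖ ≤ C * B) ∧
      (∀ B' : ℝ, (∀ j, ‖((1 / 2 : ℂ) • (((CurlOp (fine n M) (n : ℂ))ᴴ * CurlOp (fine n M) (n : ℂ)) *ᵥ x)) j‖ ≤ B') →
        ∀ i, ‖(x - GradOp (fine n M) (n : ℂ) *ᵥ lambda0 n M (n : ℂ) ((GradOp (fine n M) (n : ℂ))ᴴ *ᵥ x)) i‖ ≤ C * B' ∧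
          (∀ ν, ‖(fdiff (fine n M) (n : ℂ) ν *ᵥ
            (x - GradOp (fine n M) (n : ℂ) *ᵥ lambda0 n M (n : ℂ) ((GradOp (fine n M) (n : ℂ))ᴴ *ᵥ x))) i‖ ≤ C * B') ∧
          ‖(Lap n M *ᵥ (x - GradOp (fine n M) (n : ℂ) *ᵥ lambda0 n M (n : ℂ) ((GradOp (fine n M) (n : ℂ))ᴴ *ᵥ x))) i‖ ≤ C * B' ∧
          ‖(GradOp (fine n M) (n : ℂ) *ᵥ ((GradOp (fine n M) (n : ℂ))ᴴ *ᵥ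
            (x - GradOp (fine n M) (n : ℂ) *ᵥ lambda0 n M (n : ℂ) ((GradOp (fine n M) (n : ℂ))ᴴ *ᵥ x)))) i‖ ≤ C * B') := by
  obtain ⟨C₀, hC₀, h0⟩ := exists_sup_const (d := d)
  obtain ⟨C₁, hC₁, h1⟩ := exists_source_const (d := d)
  obtain ⟨C₂, hC₂, h2⟩ := exists_grad_const (d := d)
  obtain ⟨C₄, hC₄, h4⟩ := exists_lap_const (d := d)
  obtain ⟨C₅, hC₅, h5⟩ := exists_gradDiv_const (d := d)
  set C := C₀ + C₁ + C₂ + C₄ + C₅ with hC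
  refine ⟨C, by positivity, fun n _ M _ x hx => ?_⟩
  have hc : (n : ℂ) ≠ 0 := by exact_mod_cast NeZero.ne n
  refine ⟨QsOp_lambda0 n M (n : ℂ) hc _, sum_lambda0 n M (n : ℂ) _, by rw [QvOp_landau, hx], residual_landau n M x,
    CurlOp_landau n M x, fun B hB i => ?_, fun B' hB' i => ⟨?_, fun ν => ?_, ?_, ?_⟩⟩
  · have hB0 : 0 ≤ B := (norm_nonneg _).trans (hB 0 0 0)
    exact (h0 n M x hx B hB i).trans (mul_le_mul_of_nonneg_right (by rw [hC]; linarith) hB0)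
  · have hB0 : 0 ≤ B' := (norm_nonneg _).trans (hB' i)
    exact (h1 n M x hx B' hB' i).trans (mul_le_mul_of_nonneg_right (by rw [hC]; linarith) hB0)
  · have hB0 : 0 ≤ B' := (norm_nonneg _).trans (hB' i)
    exact (h2 n M x hx B' hB' ν i).trans (mul_le_mul_of_nonneg_right (by rw [hC]; linarith) hB0)
  · have hB0 : 0 ≤ B' := (norm_nonneg _).trans (hB' i)
    exact (h4 n M x hx B' hB' i).trans (mul_le_mul_of_nonneg_right (by rw [hC]; linarith) hB0)
  · have hB0 : 0 ≤ B' := (norm_nonneg _).trans (hB' i)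
    exact (h5 n M x hx B' hB' i).trans (mul_le_mul_of_nonneg_right (by rw [hC]; linarith) hB0)

end

end Summit.QuantumFields.BalabanUV.T4Continuum.NE7LandauLinearSup
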